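import Mathlib

/-!
# Zero-error codes over gadgets of direct pairs lift to SDPP families (support file)

Item `stmt-MatrixMultiplication-14308` (`FourierTwoFamiliesModP.PrimeTwoFamilies`, CKSU 2005 Conj. 4.7 with
prime cyclic hosts), line `Sketch` (cycle c1, capacity-gadget form; idea `zero-error-capacity-gadgets`).

A GADGET is a list of pairs `(P σ, Q σ)_{σ<r}` of finite subsets of an abelian group `K`, each DIRECT
(`(x - x') + (y - y') = 0 → x = x' ∧ y = y'` inside one pair).  Letter `σ` is STRONGLY SEPARATED towards
`τ` if every cross difference `q - p` (`p ∈ P σ`, `q ∈ Q τ`) differs from every diagonal difference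
`q' - p'` (`p' ∈ P c`, `q' ∈ Q c`, any `c`).  A finite set `W` of words `Fin L → Fin r` in which every
ORDERED pair of distinct words is strongly separated in some coordinate (a zero-error code for the
strong-separation digraph) lifts to a family of product blocks `A w = ∏ₜ P (w t)`, `B w = ∏ₜ Q (w t)` in
`Fin L → K` satisfying the two clauses (W), (X) of the simultaneous double product property verbatim
(`codeLift`).  The L = 2 instance with graph words `(σ, π σ)` of a map `π` separating every ordered pair of
distinct letters directly or after `π` is `selfConverseLift` (Lovász's `Θ = √r` code for self-converse
patterns, in gadget form).  Both generalise the constant-sum (transitive) lift `LadderLift.stub_lift`.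
-/

-- single-conjunct summit: the mandated namespace repeats `MatrixMultiplication` (summit = sub-problem).
set_option linter.dupNamespace false

namespace Summit.MatrixMultiplication.MatrixMultiplication.Theorems.PrimeTwoFamilies.CapacityLift

open Finset

/-- **CODE LIFT.**  If every letter `(P c, Q c)` is direct (`hD`) and `W` is a zero-error code for strong
separation (`hW`: for words `i ≠ k` in `W` some coordinate `t` has every cross difference `q - p`,
`p ∈ P (i t)`, `q ∈ Q (k t)`, distinct from every diagonal difference `q' - p'`, `p' ∈ P c`, `q' ∈ Q c`),
then the product blocks `A w = ∏ₜ P (w t)`, `B w = ∏ₜ Q (w t)` (`w ∈ W`) satisfy clause (W) (first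
conjunct) and clause (X) (second conjunct) of the simultaneous double product property. -/
theorem codeLift {K : Type*} [AddCommGroup K] [DecidableEq K] {r L : ℕ}
    (P Q : Fin r → Finset K)
    (hD : ∀ c : Fin r, ∀ x ∈ P c, ∀ x' ∈ P c, ∀ y ∈ Q c, ∀ y' ∈ Q c,
      (x - x') + (y - y') = 0 → x = x' ∧ y = y')
    (W : Finset (Fin L → Fin r))
    (hW : ∀ i ∈ W, ∀ k ∈ W, i ≠ k → ∃ t : Fin L,
      ∀ p ∈ P (i t), ∀ q ∈ Q (k t), ∀ c : Fin r, ∀ p' ∈ P c, ∀ q' ∈ Q c, q - p ≠ q' - p') :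
    (∀ w ∈ W, ∀ a ∈ Fintype.piFinset (fun t => P (w t)), ∀ a' ∈ Fintype.piFinset (fun t => P (w t)),
      ∀ b ∈ Fintype.piFinset (fun t => Q (w t)), ∀ b' ∈ Fintype.piFinset (fun t => Q (w t)),
        (a - a') + (b - b') = 0 → a = a' ∧ b = b') ∧
    (∀ i ∈ W, ∀ j ∈ W, ∀ k ∈ W,
      ∀ a ∈ Fintype.piFinset (fun t => P (i t)), ∀ a' ∈ Fintype.piFinset (fun t => P (j t)),
      ∀ b ∈ Fintype.piFinset (fun t => Q (j t)), ∀ b' ∈ Fintype.piFinset (fun t => Q (k t)),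
        (a - a') + (b - b') = 0 → i = k) := by
  refine ⟨?_, ?_⟩
  · -- (W): coordinatewise directness
    intro w _ a ha a' ha' b hb b' hb' h
    rw [Fintype.mem_piFinset] at ha ha' hb hb'
    have key : ∀ t, a t = a' t ∧ b t = b' t := fun t =>
      hD (w t) (a t) (ha t) (a' t) (ha' t) (b t) (hb t) (b' t) (hb' t)
        (by have := congrFun h t; simpa using this)
    exact ⟨funext fun t => (key t).1, funext fun t => (key t).2⟩
  · -- (X): at the separating coordinate the relation is a forbidden coincidence of differences
    intro i hi j _ k hk a ha a' ha' b hb b' hb' h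
    rw [Fintype.mem_piFinset] at ha ha' hb hb'
    by_contra hik
    obtain ⟨t, ht⟩ := hW i hi k hk hik
    have key : (a t - a' t) + (b t - b' t) = 0 := by
      have := congrFun h t; simpa using this
    have e : b' t - a t = b t - a' t := by
      have h2 : (a t - a' t) + (b t - b' t) = (b t - a' t) - (b' t - a t) := by abel
      rw [h2] at key
      exact (sub_eq_zero.1 key).symm
    exact ht (a t) (ha t) (b' t) (hb' t) (j t) (a' t) (ha' t) (b t) (hb t) e

/-- **SELF-CONVERSE LIFT** (the L = 2 code of graph words).  If every letter is direct and a map `π` on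
the letters strongly separates every ordered pair of distinct letters either directly or after `π`, then
the `r` blocks `(P σ ×ˢ P (π σ), Q σ ×ˢ Q (π σ))` in `K × K` satisfy (W) (first conjunct) and (X) (second
conjunct).  Shannon's pentagon code `u ↦ 2u` over the letters `({u}, {u, u+1})` of `ℤ/5` is an instance
(5 blocks in `ℤ/5 × ℤ/5`, where at most 2 letters are pairwise separated). -/
theorem selfConverseLift {K : Type*} [AddCommGroup K] [DecidableEq K] {r : ℕ}
    (P Q : Fin r → Finset K)
    (hD : ∀ c : Fin r, ∀ x ∈ P c, ∀ x' ∈ P c, ∀ y ∈ Q c, ∀ y' ∈ Q c,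
      (x - x') + (y - y') = 0 → x = x' ∧ y = y')
    (π : Fin r → Fin r)
    (hπ : ∀ σ τ : Fin r, σ ≠ τ →
      (∀ p ∈ P σ, ∀ q ∈ Q τ, ∀ c : Fin r, ∀ p' ∈ P c, ∀ q' ∈ Q c, q - p ≠ q' - p') ∨
      (∀ p ∈ P (π σ), ∀ q ∈ Q (π τ), ∀ c : Fin r, ∀ p' ∈ P c, ∀ q' ∈ Q c, q - p ≠ q' - p')) :
    (∀ σ : Fin r, ∀ a ∈ P σ ×ˢ P (π σ), ∀ a' ∈ P σ ×ˢ P (π σ),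
      ∀ b ∈ Q σ ×ˢ Q (π σ), ∀ b' ∈ Q σ ×ˢ Q (π σ),
        (a - a') + (b - b') = 0 → a = a' ∧ b = b') ∧
    (∀ i j k : Fin r, ∀ a ∈ P i ×ˢ P (π i), ∀ a' ∈ P j ×ˢ P (π j),
      ∀ b ∈ Q j ×ˢ Q (π j), ∀ b' ∈ Q k ×ˢ Q (π k),
        (a - a') + (b - b') = 0 → i = k) := by
  refine ⟨?_, ?_⟩
  · intro σ a ha a' ha' b hb b' hb' h
    rw [Finset.mem_product] at ha ha' hb hb'
    have h1 : (a.1 - a'.1) + (b.1 - b'.1) = 0 := by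
      have := congrArg Prod.fst h; simpa using this
    have h2 : (a.2 - a'.2) + (b.2 - b'.2) = 0 := by
      have := congrArg Prod.snd h; simpa using this
    obtain ⟨e1, f1⟩ := hD σ a.1 ha.1 a'.1 ha'.1 b.1 hb.1 b'.1 hb'.1 h1
    obtain ⟨e2, f2⟩ := hD (π σ) a.2 ha.2 a'.2 ha'.2 b.2 hb.2 b'.2 hb'.2 h2
    exact ⟨Prod.ext e1 e2, Prod.ext f1 f2⟩
  · intro i j k a ha a' ha' b hb b' hb' h
    rw [Finset.mem_product] at ha ha' hb hb'
    by_contra hik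
    have h1 : (a.1 - a'.1) + (b.1 - b'.1) = 0 := by
      have := congrArg Prod.fst h; simpa using this
    have h2 : (a.2 - a'.2) + (b.2 - b'.2) = 0 := by
      have := congrArg Prod.snd h; simpa using this
    rcases hπ i k hik with hs | hs
    · have e : b'.1 - a.1 = b.1 - a'.1 := by
        have h3 : (a.1 - a'.1) + (b.1 - b'.1) = (b.1 - a'.1) - (b'.1 - a.1) := by abel
        rw [h3] at h1
        exact (sub_eq_zero.1 h1).symm
      exact hs a.1 ha.1 b'.1 hb'.1 j a'.1 ha'.1 b.1 hb.1 e
    · have e : b'.2 - a.2 = b.2 - a'.2 := by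
        have h3 : (a.2 - a'.2) + (b.2 - b'.2) = (b.2 - a'.2) - (b'.2 - a.2) := by abel
        rw [h3] at h2
        exact (sub_eq_zero.1 h2).symm
      exact hs a.2 ha.2 b'.2 hb'.2 (π j) a'.2 ha'.2 b.2 hb.2 e

end Summit.MatrixMultiplication.MatrixMultiplication.Theorems.PrimeTwoFamilies.CapacityLift
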